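import Literature.NumberTheory.QuadraticForms.HilbertReciprocityInputs
import Literature.NumberTheory.QuadraticForms.HilbertReciprocityReduction
import Literature.NumberTheory.QuadraticForms.InertQuadraticExtension
import Literature.NumberTheory.QuadraticForms.HilbertSymbolNegOneReciprocity
import Literature.NumberTheory.QuadraticForms.LocalNormIndex
import Literature.NumberTheory.QuadraticForms.ExistsPlacesGeneratorsNonsquareProofs
import Literature.NumberTheory.Automorphic.QuaternionAlgebraClassification
import HarnessLib

/-!
# Hilbert's reciprocity law (O'Meara 71:18) from the second inequality, Hasse's norm theorem
# and 71:17; parity of the ramification of quaternion algebras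

Topic `NumberTheory/QuadraticForms`; namespaces `Literature.NumberTheory.QuadraticForms` (Hilbert
reciprocity) and `Literature.NumberTheory.Automorphic` (quaternion algebras); all declarations fully
proved. Main results:

* `hilbertReciprocity_of_facts` : for a number field `K`, **Hilbert's reciprocity law**
  `hilbertReciprocity K a b` for all `a b` (O'Meara Thm. 71:18: `∏_𝔭 (a, b)_𝔭 = 1`, i.e. the number
  of places with `(a, b)_𝔭 = -1` is finite and even; `HilbertSymbol.lean`) follows from
  1. `normIdeles_index_dvd_two K` — the second inequality `(J_K : P_K N_{E/K} J_E) ∣ 2` for the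
     quadratic extensions `E = K(√b)` (O'Meara 65:21, proof; `QuadraticNormIndex.lean`);
  2. `Literature.NumberTheory.Automorphic.exists_sq_eq_of_not_isSquare_ramified K ℍ[K,a,b]` for
     all `a b` — a quadratic field `K(√θ)` with `K_v(√θ)` a field at every place ramified in the
     quaternion algebra `ℍ[K,a,b]` embeds in it (Vignéras III Thm. 3.8 (1),
     `Automorphic/QuaternionAlgebraEmbedding.lean`); by
     `exists_sq_eq_of_not_isSquare_ramified_of_hasseNorm` (`LocalNormIndex.lean`) this is a
     consequence of **Hasse's norm theorem** for the quadratic extensions of the quadratic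
     extensions of `K` (`Automorphic.hilbertSymbol_eq_one_of_forall_completions`, Vignéras III
     Cor. 3.4 = O'Meara 65:23) — whence the variant `hilbertReciprocity_of_hasseNorm`;
  3. `range_localUnits_not_le_of_inertiaDegIn_eq_two K` — O'Meara 71:17
     (`HilbertReciprocityInputs.lean`);
  together with O'Meara 71:13, which is **proved** (`hilbertSymbol_neg_one_reciprocity_holds`,
  `HilbertSymbolNegOneReciprocity.lean`).
* `Literature.NumberTheory.Automorphic.even_card_ramified_of_facts` (and `…_of_hasseNorm`): the
  named fact `even_card_ramified K D` of `Automorphic/QuaternionAlgebraAdelic.lean` (Vignéras III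
  Thm. 3.1: a quaternion algebra over a number field is ramified at an even number of places) under
  the same three hypotheses (`even_card_ramified_of_hilbertReciprocity`,
  `Automorphic/QuaternionRamificationParity.lean`).

## The proof (O'Meara §71D, proof of 71:18, in quaternionic dress)

Fix `a b ∈ Kˣ` and suppose the number of places with `(a, b)_𝔭 = -1` is odd. By
`exists_hilbertSymbol_eq_neg_one_unique` (`HilbertReciprocityReduction.lean`, input 1) some
`a' ∈ Kˣ` has `(a', b)_𝔭 = -1` at exactly one place `𝔮`. The quaternion algebra `H = (a', b / K)`
is then ramified exactly at `𝔮` (`ramifiedPlaces_eq_of_algEquiv`), in particular it is a division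
algebra.

* `𝔮 = w₀` real. `-1` is a non-square in `K_{w₀} ≅ ℝ`, so `K(√-1) ↪ H` (input 2): `x² = -1`, and
  `H ≅ (-1, c / K)` for some `c` (`exists_algEquiv_quaternionAlgebra_of_mul_self_eq`: Vignéras I
  §2, a quaternionic basis starting from any `x ∉ K` with `x² ∈ K`). Ramification being an
  isomorphism invariant, `(c, -1)_𝔭 = (a', b)_𝔭` is `-1` exactly at the real place `w₀` — against
  71:13 (proved). [O'Meara: "`β' = -1` when `𝔮` is real … impossible by Proposition 71:13".]
* `𝔮 = v₀` finite. Let `θ ∈ K` be a non-square in `K_{v₀}` with `E = K(√θ)` unramified of local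
  degree `2` at `v₀` (`exists_inert_quadraticExtension`, `InertQuadraticExtension.lean`; O'Meara's
  "unit of quadratic defect `4𝔬_𝔮`"). Then `K(√θ) ↪ H` (input 2), `H ≅ (θ, c / K)`, and `(c, θ)_𝔭`
  is `-1` exactly at `v₀`; so `c` is a local norm from `K_v(√θ)` at every `v ≠ v₀` and at the
  infinite places, and a non-norm at `v₀`. Hence `I_K^{v₀} ⊆ P_K · N_{E/K} J_E`: a `v₀`-idèle whose
  component is a local norm is a norm idèle, and one whose component `u` is not has `(c) · u` a norm
  idèle, the local norm index at `v₀` being `2` (`index_quadraticNormSubgroup_adicCompletion_eq_two`,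
  `LocalNormIndex.lean`) — against 71:17 (input 3). [O'Meara: "We claim that
  `I_F^𝔮 ⊆ P_F N_{E/F} J_E` … This is impossible by Proposition 71:17."]

O'Meara alters `β` to `β'` through the Hasse–Minkowski theorem 66:1 for the quaternary form
`⟨α, β, -αβ, -β'⟩` (whose proof, 66:1 step 4, is Hasse's norm theorem over `F(√β')`) and reads the
new `α'` off `⟨α, β, -αβ⟩ ≅ ⟨α', β', -α'β'⟩`; the embedding `F(√β') ↪ (α, β / F)` used here is the
same statement for the pure quaternions, with the same class-field-theoretic input.

## References

* O. T. O'Meara, *Introduction to quadratic forms*, Grundlehren 117, Springer (1963), §71D,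
  Thm. 71:18 and its proof (PDF pp. 207–208); Props. 71:13, 71:17; §65D 65:21; §63B 63:13a.
* M.-F. Vignéras, *Arithmétique des algèbres de quaternions*, LNM 800 (1980), Ch. I §2;
  Ch. III §3 Thm. 3.1, Cor. 3.3 ("ce résultat est équivalent à la loi de réciprocité du symbole de
  Hilbert"), Cor. 3.4, Thm. 3.8.
-/

noncomputable section

open scoped Quaternion
open NumberField IsDedekindDomain Module

universe u

/-! ### A quaternionic basis with prescribed first vector -/

namespace Literature.NumberTheory.Automorphic

section Structure

variable {K : Type*} {D : Type*} [Field K] [Ring D] [Algebra K D]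

/-- **Quaternionic basis through a given quadratic element** (Vignéras I §2, proof of Cor. 2.2 /
Cor. 2.5, as in `exists_algEquiv_quaternionAlgebra_of_forall_isUnit`): in a central division
algebra `D` of dimension `4` over a field `K` with `2 ≠ 0`, an element `x` with `x² = θ ∈ K`,
`θ ∉ K²`, can be taken as the first basis vector `i`: `D ≃ₐ[K] ℍ[K,θ,c]` for some `c ∈ Kˣ`
(`j` anticommuting with `x`, `exists_anticommute_of_sq_eq_algebraMap`). In particular a quadratic
subfield `K(√θ) ⊆ D` exhibits `D` as `(θ, c / K)`. [cite: VignerasLNM800, Ch. I §2 Cor. 2.2 (proof)] -/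
theorem exists_algEquiv_quaternionAlgebra_of_mul_self_eq [NeZero (2 : K)] [Algebra.IsCentral K D]
    (hD : ∀ x : D, x ≠ 0 → IsUnit x) (h4 : finrank K D = 4) {x : D} {θ : K}
    (hx : x * x = algebraMap K D θ) (hθ : ¬ IsSquare θ) :
    ∃ c : K, c ≠ 0 ∧ Nonempty (D ≃ₐ[K] ℍ[K,θ,c]) := by
  haveI : Nontrivial D := Module.nontrivial_of_finrank_pos (R := K) (by omega)
  haveI : FiniteDimensional K D := Module.finite_of_finrank_pos (by omega)
  have hθ0 : θ ≠ 0 := by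
    rintro rfl
    exact hθ IsSquare.zero
  have hxK : x ∉ (⊥ : Subalgebra K D) := by
    intro hmem
    obtain ⟨r, hr⟩ := Algebra.mem_bot.mp hmem
    apply hθ
    refine ⟨r, (algebraMap K D).injective ?_⟩
    rw [map_mul, hr, hx]
  obtain ⟨j, -, hji, c, hc, hjj⟩ := exists_anticommute_of_sq_eq_algebraMap hD h4 hxK hx
  let B : _root_.QuaternionAlgebra.Basis (R := K) D θ 0 c :=
    { i := x, j := j, k := x * j
      i_mul_i := by rw [hx, Algebra.algebraMap_eq_smul_one, zero_smul, add_zero]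
      j_mul_j := by rw [hjj, Algebra.algebraMap_eq_smul_one]
      i_mul_j := rfl
      j_mul_i := by rw [hji, zero_smul, zero_sub] }
  haveI := QuaternionAlgebra.isSimpleRing hθ0 hc
  have hinj : Function.Injective B.liftHom := RingHom.injective B.liftHom.toRingHom
  have hsurj : Function.Surjective B.liftHom :=
    (LinearMap.injective_iff_surjective_of_finrank_eq_finrank (f := B.liftHom.toLinearMap)
      (by rw [_root_.QuaternionAlgebra.finrank_eq_four, h4])).mp hinj
  exact ⟨c, hc, ⟨(AlgEquiv.ofBijective B.liftHom ⟨hinj, hsurj⟩).symm⟩⟩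

end Structure

/-! ### The quaternion algebra of a pair with a single exceptional place -/

section SingleBadPlace

variable (K : Type) [Field K] [NumberField K]

/-- `ℍ[K,a,b]` (`a b ≠ 0`) is a quaternion algebra over the number field `K`
(`QuaternionAlgebra.isQuaternionAlgebra_holds`). [folklore] -/
theorem isQuaternionAlgebra_quaternionAlgebra {a b : K} (ha : a ≠ 0) (hb : b ≠ 0) :
    IsQuaternionAlgebra K ℍ[K,a,b] :=
  haveI : NeZero (2 : K) := ⟨two_ne_zero⟩
  QuaternionAlgebra.isQuaternionAlgebra_holds ha hb

/-- A quaternion algebra `ℍ[K,a,b]` over a number field which is ramified at some finite place is a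
division algebra (a split algebra `≃ M₂(K) ≃ ℍ[K,1,1]` is split everywhere, `(1, 1)_v = 1`;
dichotomy `IsQuaternionAlgebra.division_or_split`). [folklore] -/
theorem forall_isUnit_of_hilbertSymbol_eq_neg_one {a b : K} (ha : a ≠ 0) (hb : b ≠ 0)
    {v : HeightOneSpectrum (𝓞 K)}
    (hv : QuadraticForms.hilbertSymbol (v.adicCompletion K) (algebraMap K _ a) (algebraMap K _ b) = -1) :
    ∀ x : ℍ[K,a,b], x ≠ 0 → IsUnit x := by
  haveI := isQuaternionAlgebra_quaternionAlgebra K ha hb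
  haveI : NeZero (2 : K) := ⟨two_ne_zero⟩
  refine (IsQuaternionAlgebra.division_or_split K ℍ[K,a,b]).resolve_right fun ⟨e⟩ ↦ ?_
  obtain ⟨f⟩ := (QuaternionAlgebra.nonempty_algEquiv_matrix_iff (F := K) (a := 1) (b := 1)
    one_ne_zero one_ne_zero).mpr ⟨1, 0, by ring⟩
  have hsplit : IsSplitAt ℍ[K,a,b] v :=
    (isSplitAt_iff_hilbertSymbol_eq_one K ℍ[K,a,b] one_ne_zero one_ne_zero (e.trans f.symm) v).mpr
      (by rw [map_one, QuadraticForms.hilbertSymbol_one_left])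
  have hram : v ∈ ramifiedPlaces K ℍ[K,a,b] := by
    rw [ramifiedPlaces_eq_of_algEquiv K ℍ[K,a,b] ha hb AlgEquiv.refl]
    exact hv
  exact hram hsplit

/-- The same at an infinite place. [folklore] -/
theorem forall_isUnit_of_hilbertSymbol_infinitePlace_eq_neg_one {a b : K} (ha : a ≠ 0) (hb : b ≠ 0)
    {w : InfinitePlace K}
    (hw : QuadraticForms.hilbertSymbol w.Completion (algebraMap K _ a) (algebraMap K _ b) = -1) :
    ∀ x : ℍ[K,a,b], x ≠ 0 → IsUnit x := by
  haveI := isQuaternionAlgebra_quaternionAlgebra K ha hb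
  haveI : NeZero (2 : K) := ⟨two_ne_zero⟩
  refine (IsQuaternionAlgebra.division_or_split K ℍ[K,a,b]).resolve_right fun ⟨e⟩ ↦ ?_
  obtain ⟨f⟩ := (QuaternionAlgebra.nonempty_algEquiv_matrix_iff (F := K) (a := 1) (b := 1)
    one_ne_zero one_ne_zero).mpr ⟨1, 0, by ring⟩
  have hsplit : IsSplitAtInfinite ℍ[K,a,b] w :=
    (isSplitAtInfinite_iff_hilbertSymbol_eq_one K ℍ[K,a,b] one_ne_zero one_ne_zero (e.trans f.symm)
      w).mpr (by rw [map_one, QuadraticForms.hilbertSymbol_one_left])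
  have hram : w ∈ ramifiedInfinitePlaces K ℍ[K,a,b] := by
    rw [ramifiedInfinitePlaces_eq_of_algEquiv K ℍ[K,a,b] ha hb AlgEquiv.refl]
    exact hw
  exact hram hsplit

/-- **Change of presentation through an embedded quadratic field.** Let `a b ∈ Kˣ`, let `θ ∉ K²`
embed in the division algebra `ℍ[K,a,b]` (`x² = θ`). Then `ℍ[K,a,b] ≅ (θ, c / K)` for some `c ∈ Kˣ`
and, ramification being an isomorphism invariant and the symbol symmetric, the local symbols
`(c, θ)_𝔭` and `(a, b)_𝔭` agree at every place, finite and infinite. [folklore] -/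
theorem exists_hilbertSymbol_eq_iff_of_mul_self_eq {a b : K} (ha : a ≠ 0) (hb : b ≠ 0)
    (hdiv : ∀ x : ℍ[K,a,b], x ≠ 0 → IsUnit x) {θ : K} (hθ : ¬ IsSquare θ) {x : ℍ[K,a,b]}
    (hx : x * x = algebraMap K _ θ) :
    ∃ c : K, c ≠ 0 ∧
      (∀ v : HeightOneSpectrum (𝓞 K),
        QuadraticForms.hilbertSymbol (v.adicCompletion K) (algebraMap K _ c) (algebraMap K _ θ) = -1 ↔
          QuadraticForms.hilbertSymbol (v.adicCompletion K) (algebraMap K _ a) (algebraMap K _ b) = -1) ∧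
      ∀ w : InfinitePlace K,
        QuadraticForms.hilbertSymbol w.Completion (algebraMap K _ c) (algebraMap K _ θ) = -1 ↔
          QuadraticForms.hilbertSymbol w.Completion (algebraMap K _ a) (algebraMap K _ b) = -1 := by
  haveI := isQuaternionAlgebra_quaternionAlgebra K ha hb
  haveI : NeZero (2 : K) := ⟨two_ne_zero⟩
  have hθ0 : θ ≠ 0 := by
    rintro rfl
    exact hθ IsSquare.zero
  obtain ⟨c, hc, ⟨e⟩⟩ := exists_algEquiv_quaternionAlgebra_of_mul_self_eq hdiv
    (IsQuaternionAlgebra.finrank_eq_four (K := K) (D := ℍ[K,a,b])) hx hθ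
  refine ⟨c, hc, fun v ↦ ?_, fun w ↦ ?_⟩
  · have h1 := Set.ext_iff.mp (ramifiedPlaces_eq_of_algEquiv K ℍ[K,a,b] hθ0 hc e) v
    have h2 := Set.ext_iff.mp (ramifiedPlaces_eq_of_algEquiv K ℍ[K,a,b] ha hb AlgEquiv.refl) v
    simp only [Set.mem_setOf_eq] at h1 h2
    rw [QuadraticForms.hilbertSymbol_comm, ← h1, h2]
  · have h1 := Set.ext_iff.mp (ramifiedInfinitePlaces_eq_of_algEquiv K ℍ[K,a,b] hθ0 hc e) w
    have h2 := Set.ext_iff.mp (ramifiedInfinitePlaces_eq_of_algEquiv K ℍ[K,a,b] ha hb AlgEquiv.refl) w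
    simp only [Set.mem_setOf_eq] at h1 h2
    rw [QuadraticForms.hilbertSymbol_comm, ← h1, h2]

end SingleBadPlace

end Literature.NumberTheory.Automorphic

/-! ### Hilbert reciprocity -/

namespace Literature.NumberTheory.QuadraticForms

open Literature.NumberTheory.Automorphic

variable (K : Type) [Field K] [NumberField K]

/-- **Step B** (O'Meara §71D, proof of 71:18, last paragraph: *"We claim that
`I_F^𝔮 ⊆ P_F N_{E/F} J_E`"*): if `c ∈ Kˣ` is a local norm from `K_𝔭(√θ)` at every place `𝔭 ≠ 𝔮`
(finite or infinite) and a non-norm at the finite place `𝔮`, where `θ` is a non-square in `K_𝔮`,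
then every `𝔮`-idèle lies in `P_K · N_{E/K} J_E`: one whose `𝔮`-component `u` is a norm is a norm
idèle, and otherwise `(c) · u` is, the local norm index at `𝔮` being `2`
(`index_quadraticNormSubgroup_adicCompletion_eq_two`). [cite: Omeara1963, §71D proof of Thm. 71:18 (step 2)] -/
theorem range_localUnits_le_of_hilbertSymbol_eq_neg_one_iff {c θ : K} (hc : c ≠ 0) (hθ : θ ≠ 0)
    {v₀ : HeightOneSpectrum (𝓞 K)} (hnsq : ¬ IsSquare (algebraMap K (v₀.adicCompletion K) θ))
    (hfin : ∀ v : HeightOneSpectrum (𝓞 K),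
      hilbertSymbol (v.adicCompletion K) (algebraMap K _ c) (algebraMap K _ θ) = -1 ↔ v = v₀)
    (hinf : ∀ w : InfinitePlace K,
      hilbertSymbol w.Completion (algebraMap K _ c) (algebraMap K _ θ) = 1) :
    (GaloisRepresentations.localUnits v₀).range ≤
      GaloisRepresentations.principalIdeles K ⊔ normIdeles K θ := by
  rintro _ ⟨u, rfl⟩
  haveI : ∀ v : HeightOneSpectrum (𝓞 K), CharZero (v.adicCompletion K) := fun v ↦
    charZero_of_injective_algebraMap (algebraMap K _).injective
  haveI : ∀ w : InfinitePlace K, CharZero w.Completion := fun w ↦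
    charZero_of_injective_algebraMap (algebraMap K _).injective
  set cK : Kˣ := Units.mk0 c hc with hcK
  set P : GaloisRepresentations.ideleGroup K :=
    Units.map (algebraMap K (AdeleRing (𝓞 K) K) : K →* _) cK with hP
  have hPmem : P ∈ GaloisRepresentations.principalIdeles K := ⟨cK, rfl⟩
  -- `c` is a local norm away from `v₀`
  have hcv : ∀ v : HeightOneSpectrum (𝓞 K), v ≠ v₀ →
      ideleFiniteComponent K v P ∈ quadraticNormSubgroup (v.adicCompletion K) (algebraMap K _ θ) := by
    intro v hv
    rw [hP, ideleFiniteComponent_principal,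
      ← hilbertSymbol_eq_one_iff_mem_quadraticNormSubgroup
        ((map_ne_zero (algebraMap K (v.adicCompletion K))).2 hθ)]
    exact (hilbertSymbol_ne_neg_one_iff _ _).1 fun h ↦ hv ((hfin v).1 h)
  have hcw : ∀ w : InfinitePlace K,
      ideleInfiniteComponent K w P ∈ quadraticNormSubgroup w.Completion (algebraMap K _ θ) := by
    intro w
    rw [hP, ideleInfiniteComponent_principal,
      ← hilbertSymbol_eq_one_iff_mem_quadraticNormSubgroup
        ((map_ne_zero (algebraMap K w.Completion)).2 hθ)]
    exact hinf w
  -- `c` is a local non-norm at `v₀`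
  have hcv₀ : ideleFiniteComponent K v₀ P ∉
      quadraticNormSubgroup (v₀.adicCompletion K) (algebraMap K _ θ) := by
    rw [hP, ideleFiniteComponent_principal,
      ← hilbertSymbol_eq_neg_one_iff_not_mem_quadraticNormSubgroup
        ((map_ne_zero (algebraMap K (v₀.adicCompletion K))).2 hθ)]
    exact (hfin v₀).2 rfl
  by_cases hu : u ∈ quadraticNormSubgroup (v₀.adicCompletion K) (algebraMap K _ θ)
  · exact Subgroup.mem_sup_right ((localUnits_mem_normIdeles_iff θ v₀ u).2 hu)
  · -- `(c) · u` is a norm idèle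
    have h2 := index_quadraticNormSubgroup_adicCompletion_eq_two K v₀
      ((map_ne_zero (algebraMap K (v₀.adicCompletion K))).2 hθ) hnsq
    have hcu : ideleFiniteComponent K v₀ P * u ∈
        quadraticNormSubgroup (v₀.adicCompletion K) (algebraMap K _ θ) :=
      (Subgroup.mul_mem_iff_of_index_two h2).2 (iff_of_false hcv₀ hu)
    have hmem : P * GaloisRepresentations.localUnits v₀ u ∈ normIdeles K θ := by
      refine mem_normIdeles_iff.2 ⟨fun v ↦ ?_, fun w ↦ ?_⟩
      · rw [map_mul]
        by_cases hv : v = v₀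
        · subst hv
          rwa [ideleFiniteComponent_localUnits_self]
        · rw [ideleFiniteComponent_localUnits_of_ne K u hv, mul_one]
          exact hcv v hv
      · rw [map_mul, ideleInfiniteComponent_localUnits, mul_one]
        exact hcw w
    have : GaloisRepresentations.localUnits v₀ u = P⁻¹ * (P * GaloisRepresentations.localUnits v₀ u) := by
      group
    rw [this]
    exact Subgroup.mul_mem _ (Subgroup.mem_sup_left (inv_mem hPmem)) (Subgroup.mem_sup_right hmem)

/-- **Hilbert's reciprocity law (O'Meara Thm. 71:18) from the second inequality, the embedding
criterion III 3.8 (1) and 71:17.** For every number field `K`: if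
`(J_K : P_K N_{E/K} J_E) ∣ 2` for the quadratic extensions of `K` (`normIdeles_index_dvd_two`,
O'Meara 65:21), if quadratic fields `K(√θ)` embed in the quaternion algebras `ℍ[K,a,b]` wherever the
local obstructions vanish (`exists_sq_eq_of_not_isSquare_ramified`, Vignéras III Thm. 3.8 (1) —
Hasse's norm theorem), and if `I_K^𝔮 ⊄ P_K N_{E/K} J_E` at inert `𝔮`
(`range_localUnits_not_le_of_inertiaDegIn_eq_two`, 71:17), then `∏_𝔭 (a, b)_𝔭 = 1` for all
`a b ∈ Kˣ` (`hilbertReciprocity K a b`); O'Meara 71:13 enters through the proved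
`hilbertSymbol_neg_one_reciprocity_holds`. See the module docstring for the proof.
[cite: Omeara1963, §71D Thm. 71:18] -/
theorem hilbertReciprocity_of_facts (h65 : normIdeles_index_dvd_two K)
    (hEmb : ∀ a b : K, exists_sq_eq_of_not_isSquare_ramified K ℍ[K,a,b])
    (h17 : range_localUnits_not_le_of_inertiaDegIn_eq_two K) (a b : K) :
    hilbertReciprocity K a b := by
  have h13 := hilbertSymbol_neg_one_reciprocity_holds K
  intro ha hb
  refine ⟨finite_setOf_hilbertSymbol_eq_neg_one K ha hb, ?_⟩
  by_contra hodd
  rw [Nat.not_even_iff_odd] at hodd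
  haveI : NeZero (2 : K) := ⟨two_ne_zero⟩
  haveI : ∀ v : HeightOneSpectrum (𝓞 K), CharZero (v.adicCompletion K) := fun v ↦
    charZero_of_injective_algebraMap (algebraMap K _).injective
  obtain ⟨a', ha', hcase⟩ := exists_hilbertSymbol_eq_neg_one_unique h65 ha hb hodd
  haveI := isQuaternionAlgebra_quaternionAlgebra K ha' hb
  rcases hcase with ⟨v₀, hfin, hinf⟩ | ⟨w₀, hinf, hfin⟩
  · -- a single finite exceptional place `v₀`: alter `b` to `θ` with `K(√θ)/K` inert at `v₀`
    obtain ⟨θ, hθ0, hnsq, E, _, _, _, _, α, hα, hαK, hf2⟩ := exists_inert_quadraticExtension K v₀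
    have hθK : ¬ IsSquare θ := fun hsq ↦ hnsq (hsq.map _)
    have hdiv := forall_isUnit_of_hilbertSymbol_eq_neg_one K ha' hb ((hfin v₀).2 rfl)
    -- `K(√θ)` embeds in `H = ℍ[K,a',b]`, ramified exactly at `v₀`
    obtain ⟨x, hx⟩ := hEmb a' b θ hθK
      (fun v hv ↦ by
        rw [ramifiedPlaces_eq_of_algEquiv K ℍ[K,a',b] ha' hb AlgEquiv.refl, Set.mem_setOf_eq,
          hfin v] at hv
        rw [hv]
        exact hnsq)
      (fun w hw ↦ by
        rw [ramifiedInfinitePlaces_eq_of_algEquiv K ℍ[K,a',b] ha' hb AlgEquiv.refl,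
          Set.mem_setOf_eq, hinf w] at hw
        norm_num at hw)
    -- `H ≅ (θ, c)`, `(c, θ)` exceptional exactly at `v₀`
    obtain ⟨c, hc, hcfin, hcinf⟩ := exists_hilbertSymbol_eq_iff_of_mul_self_eq K ha' hb hdiv hθK hx
    refine h17 E θ α hα hαK v₀ hf2
      (range_localUnits_le_of_hilbertSymbol_eq_neg_one_iff K hc hθ0 hnsq (fun v ↦ ?_) fun w ↦ ?_)
    · rw [hcfin v, hfin v]
    · exact (hilbertSymbol_ne_neg_one_iff _ _).1 fun h ↦ by
        have := (hcinf w).1 h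
        rw [hinf w] at this
        norm_num at this
  · -- a single real exceptional place `w₀`: alter `b` to `-1`
    have hw₀ : w₀.IsReal :=
      isReal_of_hilbertSymbol_completion_eq_neg_one (Or.inl ha') ((hinf w₀).2 rfl)
    have hneg : InfinitePlace.embedding_of_isReal hw₀ (-1 : K) < 0 := by
      rw [map_neg, map_one]
      norm_num
    have hnsq : ¬ IsSquare (algebraMap K w₀.Completion (-1)) :=
      not_isSquare_completion_of_embedding_neg K hw₀ hneg
    have hθK : ¬ IsSquare (-1 : K) := fun hsq ↦ hnsq (hsq.map _)
    have hdiv := forall_isUnit_of_hilbertSymbol_infinitePlace_eq_neg_one K ha' hb ((hinf w₀).2 rfl)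
    obtain ⟨x, hx⟩ := hEmb a' b (-1) hθK
      (fun v hv ↦ by
        rw [ramifiedPlaces_eq_of_algEquiv K ℍ[K,a',b] ha' hb AlgEquiv.refl, Set.mem_setOf_eq,
          hfin v] at hv
        norm_num at hv)
      (fun w hw ↦ by
        rw [ramifiedInfinitePlaces_eq_of_algEquiv K ℍ[K,a',b] ha' hb AlgEquiv.refl,
          Set.mem_setOf_eq, hinf w] at hw
        rw [hw]
        exact hnsq)
    obtain ⟨c, hc, hcfin, hcinf⟩ := exists_hilbertSymbol_eq_iff_of_mul_self_eq K ha' hb hdiv hθK hx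
    -- `(c, -1)` is `1` at all finite places and `-1` exactly at `w₀`: against 71:13
    have heven := h13 c hc fun v ↦ by
      rw [show (-1 : v.adicCompletion K) = algebraMap K _ (-1) by rw [map_neg, map_one]]
      exact (hilbertSymbol_ne_neg_one_iff _ _).1 fun h ↦ by
        have := (hcfin v).1 h
        rw [hfin v] at this
        norm_num at this
    have hset : {w : InfinitePlace K |
        hilbertSymbol w.Completion (algebraMap K _ c) (-1) = -1} = {w₀} := by
      ext w
      rw [Set.mem_setOf_eq, Set.mem_singleton_iff,
        show (-1 : w.Completion) = algebraMap K _ (-1) by rw [map_neg, map_one], hcinf w, hinf w]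
    rw [hset, Set.ncard_singleton] at heven
    exact Nat.not_even_one heven

/-- **Hilbert's reciprocity law from the second inequality, Hasse's norm theorem and 71:17**: as
`hilbertReciprocity_of_facts`, with the embedding criterion supplied by Hasse's norm theorem for
quadratic extensions of number fields (`Automorphic.hilbertSymbol_eq_one_of_forall_completions`,
Vignéras III Cor. 3.4 / O'Meara 65:23) through `exists_sq_eq_of_not_isSquare_ramified_of_hasseNorm`
(`LocalNormIndex.lean`). [cite: Omeara1963, §71D Thm. 71:18] -/
theorem hilbertReciprocity_of_hasseNorm (h65 : normIdeles_index_dvd_two K)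
    (hN : ∀ (L : Type) [Field L] [NumberField L] [Algebra K L] (c d : L),
      hilbertSymbol_eq_one_of_forall_completions L c d)
    (h17 : range_localUnits_not_le_of_inertiaDegIn_eq_two K) (a b : K) :
    hilbertReciprocity K a b :=
  hilbertReciprocity_of_facts K h65
    (fun a b ↦ exists_sq_eq_of_not_isSquare_ramified_of_hasseNorm K ℍ[K,a,b] hN) h17 a b

/-- **Hilbert's reciprocity law from `J_K ≠ P_K N_{E/K} J_E`, Hasse's norm theorem and 71:17.**
The second inequality being proved in the tree up to the properness of `P_K · N_{E/K} J_E`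
(`OMeara65.normIdeles_index_dvd_two_of_ne_top`: 65:18, 65:18a, 65:12 and the Global Square Theorem
are theorems), Hilbert reciprocity for `K` follows from: `principalIdeles K ⊔ normIdeles K θ ≠ ⊤`
for every non-square `θ` (the only use of the first inequality 65:14), Hasse's norm theorem for the
quadratic extensions of the quadratic extensions of `K`, and O'Meara 71:17.
[cite: Omeara1963, §71D Thm. 71:18] -/
theorem hilbertReciprocity_of_ne_top_of_hasseNorm
    (hne : ∀ θ : K, ¬ IsSquare θ →
      GaloisRepresentations.principalIdeles K ⊔ normIdeles K θ ≠ ⊤)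
    (hN : ∀ (L : Type) [Field L] [NumberField L] [Algebra K L] (c d : L),
      hilbertSymbol_eq_one_of_forall_completions L c d)
    (h17 : range_localUnits_not_le_of_inertiaDegIn_eq_two K) (a b : K) :
    hilbertReciprocity K a b :=
  hilbertReciprocity_of_hasseNorm K (OMeara65.normIdeles_index_dvd_two_of_ne_top K hne) hN h17 a b

end Literature.NumberTheory.QuadraticForms

/-! ### Parity of the ramification of quaternion algebras (Vignéras III Thm. 3.1) -/

namespace Literature.NumberTheory.Automorphic

variable (K : Type) [Field K] [NumberField K] (D : Type u) [Ring D] [Algebra K D]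

/-- **Vignéras III Thm. 3.1 (parity), from the three remaining inputs of Hilbert reciprocity**:
the named fact `even_card_ramified K D` of `QuaternionAlgebraAdelic.lean` — a quaternion algebra
over the number field `K` is ramified at an even number of places — follows from the second
inequality `normIdeles_index_dvd_two K` (O'Meara 65:21), the embedding criterion
`exists_sq_eq_of_not_isSquare_ramified K ℍ[K,a,b]` (III Thm. 3.8 (1)) and O'Meara 71:17
(`range_localUnits_not_le_of_inertiaDegIn_eq_two K`), by
`even_card_ramified_of_hilbertReciprocity` and `hilbertReciprocity_of_facts`.
[cite: VignerasLNM800, Ch. III §3 Thm. 3.1] -/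
theorem even_card_ramified_of_facts (h65 : QuadraticForms.normIdeles_index_dvd_two K)
    (hEmb : ∀ a b : K, exists_sq_eq_of_not_isSquare_ramified K ℍ[K,a,b])
    (h17 : QuadraticForms.range_localUnits_not_le_of_inertiaDegIn_eq_two K) :
    even_card_ramified K D :=
  even_card_ramified_of_hilbertReciprocity K D
    (QuadraticForms.hilbertReciprocity_of_facts K h65 hEmb h17)

/-- **Vignéras III Thm. 3.1 (parity) from the second inequality, Hasse's norm theorem and 71:17**
(`hilbertReciprocity_of_hasseNorm`). [cite: VignerasLNM800, Ch. III §3 Thm. 3.1] -/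
theorem even_card_ramified_of_hasseNorm (h65 : QuadraticForms.normIdeles_index_dvd_two K)
    (hN : ∀ (L : Type) [Field L] [NumberField L] [Algebra K L] (c d : L),
      hilbertSymbol_eq_one_of_forall_completions L c d)
    (h17 : QuadraticForms.range_localUnits_not_le_of_inertiaDegIn_eq_two K) :
    even_card_ramified K D :=
  even_card_ramified_of_hilbertReciprocity K D
    (QuadraticForms.hilbertReciprocity_of_hasseNorm K h65 hN h17)


/-- **Vignéras III Thm. 3.1 (parity) from `J_K ≠ P_K N_{E/K} J_E`, Hasse's norm theorem and
71:17** (`hilbertReciprocity_of_ne_top_of_hasseNorm`): the sharpest form of the residual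
class-field-theoretic debt of `even_card_ramified`. [cite: VignerasLNM800, Ch. III §3 Thm. 3.1] -/
theorem even_card_ramified_of_ne_top_of_hasseNorm
    (hne : ∀ θ : K, ¬ IsSquare θ →
      GaloisRepresentations.principalIdeles K ⊔ QuadraticForms.normIdeles K θ ≠ ⊤)
    (hN : ∀ (L : Type) [Field L] [NumberField L] [Algebra K L] (c d : L),
      hilbertSymbol_eq_one_of_forall_completions L c d)
    (h17 : QuadraticForms.range_localUnits_not_le_of_inertiaDegIn_eq_two K) :
    even_card_ramified K D :=
  even_card_ramified_of_hilbertReciprocity K D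
    (QuadraticForms.hilbertReciprocity_of_ne_top_of_hasseNorm K hne hN h17)

end Literature.NumberTheory.Automorphic
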